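import Literature.Probability.RandomPlanarGeometry.YangBaxterSAWStripMonotone
import Literature.Probability.RandomPlanarGeometry.YangBaxterSAWYBE
import HarnessLib

/-!
# Barrier catalogue (SAWScalingLimit): the printed range `[π/3, 2π/3]` is EXACTLY the positivity range of the
Glazman–Manolescu weights

[GlazmanManolescu2019, §1, eq. (1)] define five plaquette weights `u₁, u₂, v, w₁, w₂` as functions of the rhombus angle
`θ` and PRINT, in the sentence after eq. (1) (arXiv v3 pp. 2–3): «Notice that the weights above are all non-negative if and
only if θ ∈ [π/3, 2π/3]. To have a probabilistic interpretation of the model, we limit ourselves to angles in this range.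
One may more generally define the model on any rhombic tiling, but certain walks may have negative weights (namely w₁ and
w₂ are negative when θ > 2π/3 and θ < π/3, respectively).» This file FORMALISES THAT SENTENCE (consolidation, as printed;
the tree already has the «if» direction: `weightU1_nonneg`, …, `weightW2_nonneg` in `YangBaxterSAWStripMonotone`, and
`u₁, u₂, v > 0` on all of `(0, π)` in `YangBaxterSAWYBE`): `weightW2_neg_of_lt` (`w₂(θ) < 0` for `θ ∈ (0, π/3)`),
`weightW1_neg_of_gt` (`w₁(θ) < 0` for `θ ∈ (2π/3, π)`), and, for `θ ∈ (0, π)`, ★ `printedWeights_nonneg_iff`: all five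
weights are `≥ 0` iff `θ ∈ [π/3, 2π/3]` (plus the trichotomy packaging and `w₁(2π/3) = 0`).
(Venture lane «pcv-sawmu»: this is why the unphysical zeros of the far-cell route-mass difference found by the lane's
zero census — roots of `w₂ + v² = 0` near `0.1844·π` — lie outside the printed range.) Elementary trigonometry.
-/

noncomputable section

namespace Literature.Probability.RandomPlanarGeometry.SAW.YangBaxter

open Real

/-- ★ **`w₂ < 0` to the LEFT of the printed range**: for `θ ∈ (0, π/3)`, `w₂(θ) < 0`
(numerator `sin(15π/8 + 3θ/8)·sin(−3θ/8) > 0`, denominator `< 0`). [cite: GlazmanManolescu2019, §1, the sentence after eq. (1) (arXiv v3 p. 3: «… non-negative if and only if θ ∈ [π/3, 2π/3] … w₁ and w₂ are negative when θ > 2π/3 and θ < π/3, respectively»)] -/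
theorem weightW2_neg_of_lt {θ : ℝ} (h0 : 0 < θ) (h1 : θ < π / 3) : weightW2 θ < 0 := by
  have hpi := Real.pi_pos
  have hden : weightDen θ < 0 := weightDen_neg_of_mem_Ioo ⟨h0, by linarith⟩
  unfold weightW2
  refine div_neg_of_pos_of_neg (mul_pos_of_neg_of_neg ?_ ?_) hden
  · rw [show 15 * π / 8 + 3 * θ / 8 = (3 * θ / 8 - π / 8) + 2 * π by ring, sin_add_two_pi]
    exact sin_neg_of_neg_of_neg_pi_lt (by linarith) (by linarith)
  · rw [sin_neg, neg_neg_iff_pos]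
    exact sin_pos_of_pos_of_lt_pi (by linarith) (by linarith)

/-- ★ **`w₁ < 0` to the RIGHT of the printed range**: for `θ ∈ (2π/3, π)`, `w₁(θ) < 0`
(numerator `sin(5π/8 + 3θ/8)·sin(5π/4 − 3θ/8) > 0`, denominator `< 0`). [cite: GlazmanManolescu2019, §1, the sentence after eq. (1) (arXiv v3 p. 3: «… non-negative if and only if θ ∈ [π/3, 2π/3] … w₁ and w₂ are negative when θ > 2π/3 and θ < π/3, respectively»)] -/
theorem weightW1_neg_of_gt {θ : ℝ} (h1 : 2 * π / 3 < θ) (h2 : θ < π) : weightW1 θ < 0 := by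
  have hpi := Real.pi_pos
  have hden : weightDen θ < 0 := weightDen_neg_of_mem_Ioo ⟨by linarith, h2⟩
  unfold weightW1
  refine div_neg_of_pos_of_neg (mul_pos ?_ ?_) hden
  · exact sin_pos_of_pos_of_lt_pi (by linarith) (by linarith)
  · exact sin_pos_of_pos_of_lt_pi (by linarith) (by linarith)

/-- `w₁` vanishes at the right end of the printed range. [cite: GlazmanManolescu2019, §1, eq. (1)] -/
theorem weightW1_two_pi_div_three : weightW1 (2 * π / 3) = 0 := by
  unfold weightW1
  rw [show 5 * π / 4 - 3 * (2 * π / 3) / 8 = π by ring, sin_pi, mul_zero, zero_div]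

/-- ★★ **THE PRINTED RANGE IS THE POSITIVITY RANGE.** For `θ ∈ (0, π)`: all five printed weights are non-negative
iff `θ ∈ [π/3, 2π/3]` — the printed sentence, formalised. [cite: GlazmanManolescu2019, §1, the sentence after eq. (1) (arXiv v3 p. 3: «Notice that the weights above are all non-negative if and only if θ ∈ [π/3, 2π/3] … w₁ and w₂ are negative when θ > 2π/3 and θ < π/3, respectively»)] -/
theorem printedWeights_nonneg_iff {θ : ℝ} (hθ : θ ∈ Set.Ioo 0 π) :
    (0 ≤ weightU1 θ ∧ 0 ≤ weightU2 θ ∧ 0 ≤ weightV θ ∧ 0 ≤ weightW1 θ ∧ 0 ≤ weightW2 θ) ↔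
      θ ∈ Set.Icc (π / 3) (2 * π / 3) := by
  constructor
  · rintro ⟨-, -, -, h4, h5⟩
    constructor
    · by_contra hlt; push Not at hlt
      exact absurd h5 (not_le.2 (weightW2_neg_of_lt hθ.1 hlt))
    · by_contra hgt; push Not at hgt
      exact absurd h4 (not_le.2 (weightW1_neg_of_gt hgt hθ.2))
  · intro h
    exact ⟨weightU1_nonneg h, weightU2_nonneg h, weightV_nonneg h, weightW1_nonneg h, weightW2_nonneg h⟩

/-- On the open printed range all five weights are strictly positive; outside it (inside `(0, π)`) one is negative —
a trichotomy form. [cite: GlazmanManolescu2019, §1, eq. (1) (θ ∈ [π/3, 2π/3])] -/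
theorem printedWeights_sign_trichotomy {θ : ℝ} (hθ : θ ∈ Set.Ioo 0 π) :
    (θ < π / 3 ∧ weightW2 θ < 0) ∨ θ ∈ Set.Icc (π / 3) (2 * π / 3) ∨ (2 * π / 3 < θ ∧ weightW1 θ < 0) := by
  rcases lt_or_ge θ (π / 3) with h | h
  · exact Or.inl ⟨h, weightW2_neg_of_lt hθ.1 h⟩
  · rcases le_or_gt θ (2 * π / 3) with h' | h'
    · exact Or.inr (Or.inl ⟨h, h'⟩)
    · exact Or.inr (Or.inr ⟨h', weightW1_neg_of_gt h' hθ.2⟩)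

end Literature.Probability.RandomPlanarGeometry.SAW.YangBaxter
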